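import Summits.KontsevichZagierPeriods.KontsevichZagierPeriods.Theorems.PentagonInKZ.Negative.EvalInstance
import Literature.NumberTheory.Transcendental.AssociatorsBaseChange
import Literature.NumberTheory.Transcendental.KZKernelConjectureForms
import Literature.Barriers.KontsevichZagierPeriods.PeriodEqualityDecidability

/-!
# `PentagonInKZ` (stmt-KontsevichZagierPeriods-11348) — negative knowledge, part 4: the summit implies the crux

`pentagonInKZ_of_kernel : KZKernelConjecture → FurushoPentagon.PentagonInKZ` and, since the summit
`KontsevichZagierPeriods` (two-representation form of Kontsevich–Zagier's Conjecture 1) is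
EQUIVALENT in the tree to the kernel form `KZKernelConjecture` (`KontsevichZagierPeriods_iff`,
`kzKernelConjecture_iff_isRational`), literally **`pentagonInKZ_of_summit : KontsevichZagierPeriods →
PentagonInKZ`**; contrapositives `not_kernel_of_not_pentagonInKZ : ¬PentagonInKZ →
¬KZKernelConjecture`, `not_summit_of_not_pentagonInKZ : ¬PentagonInKZ → ¬KontsevichZagierPeriods`.
So a refutation of the crux IS a disproof of the summit: it must exhibit an additive,
multiplicative move-invariant `χ` finer than evaluation.  Together with part 1 §2 (no
counterexample at `χ = eval`) this closes both refutation avenues.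

Ingredients: `reg_ш` is `ℤ`-valued (`intValued_shuffleReg`), so every coefficient of `Φ_χ` is
`χ` of ONE formal combination (`cruxLift`, `chi_cruxLift`, for every additive `χ`); the
`ℚ`-subalgebra `Peff ⊆ ℝ` of values of formal combinations (rational constants by the tree's
`Literature.Barriers.KontsevichZagierPeriods.KZ.constRep`); the factorisation `realise` of a
realisation through `Peff` under the kernel hypothesis; Drinfeld's theorem over `ℝ`
(`drinfeldAssociator_pentagon_holds`) REFLECTED along the injective map of `ℚ`-algebras
`Peff ↪ ℝ` (`NCSeries.DrinfeldPentagon.of_map_injective`, `AssociatorsBaseChange.lean`) and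
pushed forward along `Peff → R` (`DrinfeldPentagon.map`). [cite: Drinfeld1991, (2.13); Furusho2003, Prop. 3.2.3; KontsevichZagier2001, §1.2 Conjecture 1]
-/

noncomputable section

open Literature.NumberTheory.Transcendental

namespace Summit.KontsevichZagierPeriods.FurushoPentagon.PentagonInKZNegative

open Summit.KontsevichZagierPeriods.KontsevichZagierPeriods.Theses.FurushoPentagon (PentagonInKZ)

/-! ## §7 WHY THE CRUX RESISTS: the kernel form of Conjecture 1 implies it

`pentagonInKZ_of_kernel`: `KZKernelConjecture → PentagonInKZ`, and since the summit
`KontsevichZagierPeriods` is equivalent to `KZKernelConjecture` in the tree, `pentagonInKZ_of_summit :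
KontsevichZagierPeriods → PentagonInKZ` — THE SUMMIT IMPLIES THE CRUX.  Hence every refutation of
the crux is a refutation of Conjecture 1 (kernel form): a realisation `χ` and a weight `N` at which
the pentagon fails produce, through §6, two formal combinations with equal value and different
`χ`, i.e. an element of `ker eval ∖ relations`.  Ingredients: integrality of `reg_ш`
(`shuffleReg` is `ℤ`-valued, so every coefficient of `Φ_χ` is `χ` of ONE formal combination
`cruxLift Z W`), the `ℚ`-subalgebra `Peff ⊆ ℝ` of values of formal combinations, the factorisation
of `χ` through `Peff` under the kernel hypothesis, Drinfeld's theorem over `ℝ`, reflection of the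
pentagon along `Peff ↪ ℝ` (§6) and push-forward along `Peff → R`. -/

/-! ### Integrality of the shuffle regularisation -/

/-- A `ℚ`-valued finitely supported function on words is `ℤ`-valued. [folklore] -/
def IntValued (f : List Bool →₀ ℚ) : Prop := ∀ v, ∃ n : ℤ, f v = n

/-- `0` is `ℤ`-valued. [folklore] -/
theorem intValued_zero : IntValued 0 := fun _ => ⟨0, by simp⟩

/-- Sums of `ℤ`-valued functions are `ℤ`-valued. [folklore] -/
theorem IntValued.add {f g : List Bool →₀ ℚ} (hf : IntValued f) (hg : IntValued g) :
    IntValued (f + g) := fun v => by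
  obtain ⟨m, hm⟩ := hf v; obtain ⟨n, hn⟩ := hg v
  exact ⟨m + n, by simp [hm, hn]⟩

/-- Integer multiples of `ℤ`-valued functions are `ℤ`-valued. [folklore] -/
theorem IntValued.smul {f : List Bool →₀ ℚ} (hf : IntValued f) (m : ℤ) :
    IntValued ((m : ℚ) • f) := fun v => by
  obtain ⟨n, hn⟩ := hf v
  exact ⟨m * n, by simp [hn]⟩

/-- `single w 1` is `ℤ`-valued. [folklore] -/
theorem intValued_single (w : List Bool) : IntValued (Finsupp.single w 1) := fun v => by
  classical
  by_cases h : w = v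
  · exact ⟨1, by simp [h]⟩
  · exact ⟨0, by simp [h]⟩

/-- Finite sums of `ℤ`-valued functions are `ℤ`-valued. [folklore] -/
theorem IntValued.finset_sum {ι : Type} (s : Finset ι) (F : ι → List Bool →₀ ℚ)
    (h : ∀ i ∈ s, IntValued (F i)) : IntValued (∑ i ∈ s, F i) := by
  classical
  induction s using Finset.induction_on with
  | empty => simpa using intValued_zero
  | insert a s ha ih =>
    rw [Finset.sum_insert ha]
    exact (h a (Finset.mem_insert_self a s)).add (ih fun i hi => h i (Finset.mem_insert_of_mem hi))

/-- `wordSum L` is `ℤ`-valued. [folklore] -/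
theorem intValued_wordSum : ∀ L : List (List Bool), IntValued (MZV.wordSum L)
  | [] => by simpa using intValued_zero
  | w :: L => by
    rw [MZV.wordSum_cons]
    exact (intValued_single w).add (intValued_wordSum L)

/-- `u ш v` is `ℤ`-valued. [folklore] -/
theorem intValued_shuffleSum (u v : List Bool) : IntValued (MZV.shuffleSum u v) :=
  intValued_wordSum _

/-- `(-1)^i • f` is `ℤ`-valued for `ℤ`-valued `f`. [folklore] -/
theorem IntValued.neg_one_pow_smul {f : List Bool →₀ ℚ} (hf : IntValued f) (i : ℕ) :
    IntValued (((-1 : ℚ) ^ i) • f) := by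
  have h := hf.smul ((-1 : ℤ) ^ i)
  simpa using h

/-- `regFront w` is `ℤ`-valued. [cite: IharaKanekoZagier2006, Cor. 5] -/
theorem intValued_regFront (w : List Bool) : IntValued (MZV.regFront w) :=
  IntValued.finset_sum _ _ fun i _ => (intValued_shuffleSum _ _).neg_one_pow_smul i

/-- `regEnd w` is `ℤ`-valued. [cite: IharaKanekoZagier2006, Cor. 5] -/
theorem intValued_regEnd (w : List Bool) : IntValued (MZV.regEnd w) :=
  IntValued.finset_sum _ _ fun k _ => (intValued_shuffleSum _ _).neg_one_pow_smul k

/-- **`reg_ш(w)` is `ℤ`-valued** (an integer combination of convergent words). [cite: IharaKanekoZagier2006, Cor. 5] -/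
theorem intValued_shuffleReg (w : List Bool) : IntValued (MZV.shuffleReg w) := by
  rw [MZV.shuffleReg, Finsupp.sum]
  refine IntValued.finset_sum _ _ fun u _ => ?_
  obtain ⟨m, hm⟩ := intValued_regEnd w u
  rw [hm]
  exact (intValued_regFront u).smul m

/-- The integer coefficient `reg_ш(W)(v) ∈ ℤ`. [folklore] -/
def regCoeff (W v : List Bool) : ℤ := Classical.choose (intValued_shuffleReg W v)

/-- `reg_ш(W)(v) = regCoeff W v`. [folklore] -/
theorem shuffleReg_eq_regCoeff (W v : List Bool) : MZV.shuffleReg W v = regCoeff W v :=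
  Classical.choose_spec (intValued_shuffleReg W v)

/-! ### One formal combination per coefficient -/

/-- **The formal lift of a coefficient of the crux series**:
`cruxLift Z W = (-1)^{#X₁(W)} Σ_v reg_ш(W)(v) · Z(index v) ∈ FormalRep` (integer combination).
[folklore] -/
def cruxLift (Z : List ℕ → KZ.FormalRep) (W : List Bool) : KZ.FormalRep :=
  ((-1 : ℤ) ^ (W.count true)) • ∑ v ∈ (MZV.shuffleReg W).support,
    regCoeff W v • (if MZV.IsConvergentWord v then Z (MZV.ofBinaryWord v) else 0)

/-- **Every coefficient of `Φ_χ` is `χ` of one formal combination**, for every ADDITIVE `χ` into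
a `ℚ`-algebra: `Φ_χ(W) = χ(cruxLift Z W)`. [folklore] -/
theorem chi_cruxLift {R : Type} [CommRing R] [Algebra ℚ R] (χ : KZ.FormalRep →+ R)
    (Z : List ℕ → KZ.FormalRep) (W : List Bool) :
    χ (cruxLift Z W) = cruxSeries R χ Z W := by
  rw [cruxLift, map_zsmul, map_sum, cruxSeries, Finsupp.sum]
  rw [show ((-1 : ℤ) ^ W.count true) • (∑ v ∈ (MZV.shuffleReg W).support,
      χ (regCoeff W v • (if MZV.IsConvergentWord v then Z (MZV.ofBinaryWord v) else 0))) =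
      ((-1 : R) ^ W.count true) * ∑ v ∈ (MZV.shuffleReg W).support,
      χ (regCoeff W v • (if MZV.IsConvergentWord v then Z (MZV.ofBinaryWord v) else 0)) by
    rw [← smul_eq_mul, ← Int.cast_smul_eq_zsmul R]; simp]
  congr 1
  refine Finset.sum_congr rfl fun v _ => ?_
  rw [map_zsmul, shuffleReg_eq_regCoeff, Int.cast_smul_eq_zsmul]
  split_ifs
  · rfl
  · simp

/-- At `χ = eval`: `eval (cruxLift Z W) = c_W(Φ_KZ)`. [cite: Furusho2003, Prop. 3.2.3] -/
theorem eval_cruxLift {Z : List ℕ → KZ.FormalRep} (hZ : AgreesWithSimplex Z) (W : List Bool) :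
    KZ.eval (cruxLift Z W) = drinfeldAssociator W := by
  rw [chi_cruxLift, cruxSeries_eval_eq_drinfeldAssociator hZ]

/-! ### The `ℚ`-subalgebra of values and the factorisation of a realisation -/

/-! The constant representation `[pt, q]` of a rational number is the tree's
`Literature.Barriers.KontsevichZagierPeriods.KZ.constRep` (`∫_{ℝ⁰} q/1`, value `q`:
`constRep_value`). -/

open Literature.Barriers.KontsevichZagierPeriods.KZ (constRep constRep_value)

/-- The domain of `[pt, q]` is `ℝ⁰`. [cite: KontsevichZagier2001, §1.1] -/
theorem constRep_domain (q : ℚ) : (constRep q).domain = Set.univ :=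
  KZ.IntegralRep.domain_ofRational _ _ _ _ _ _

/-- The integrand of `[pt, q]` is the constant `q`. [cite: KontsevichZagier2001, §1.1] -/
theorem constRep_integrand (q : ℚ) (x : Fin 0 → ℝ) : (constRep q).integrand x = q := by
  simp [Literature.Barriers.KontsevichZagierPeriods.KZ.constRep, KZ.IntegralRep.ofRational]

/-- **The `ℚ`-subalgebra `Peff ⊆ ℝ` of values of formal combinations** (closed under products by
the Fubini product `KZ.eval_mul'`, contains `ℚ` by the constant representations). [cite: KontsevichZagier2001, §1.1] -/
def Peff : Subalgebra ℚ ℝ where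
  carrier := {x | ∃ c : KZ.FormalRep, KZ.eval c = x}
  mul_mem' := by
    rintro _ _ ⟨c, rfl⟩ ⟨d, rfl⟩
    exact ⟨c * d, KZ.eval_mul' c d⟩
  one_mem' := ⟨KZ.of KZ.IntegralRep.unit, eval_of_unit⟩
  add_mem' := by
    rintro _ _ ⟨c, rfl⟩ ⟨d, rfl⟩
    exact ⟨c + d, map_add _ _ _⟩
  zero_mem' := ⟨0, map_zero _⟩
  algebraMap_mem' q := ⟨KZ.of (constRep q), by rw [KZ.eval_of, constRep_value, eq_ratCast]⟩

/-- Under the kernel hypothesis a realisation only depends on the value. [folklore] -/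
theorem chi_eq_of_eval_eq (hker : KZKernelConjecture)
    {R : Type} [CommRing R] {χ : KZ.FormalRep →+ R} (hχ : IsRealisation R χ)
    {c c' : KZ.FormalRep} (h : KZ.eval c = KZ.eval c') : χ c = χ c' := by
  have h0 := hχ.rel _ (hker (c - c') (by rw [map_sub, h, sub_self]))
  rwa [map_sub, sub_eq_zero] at h0

/-- **Factorisation of a realisation through `Peff`** under the kernel hypothesis:
`ψ(eval c) := χ(c)` is a well-defined ring homomorphism `Peff → R`. [folklore] -/
def realise (hker : KZKernelConjecture)
    {R : Type} [CommRing R] (χ : KZ.FormalRep →+ R) (hχ : IsRealisation R χ) : Peff →+* R where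
  toFun x := χ (Classical.choose x.2)
  map_one' := by
    have h1 := Classical.choose_spec (1 : Peff).2
    rw [← chi_unit hχ]
    exact chi_eq_of_eval_eq hker hχ (h1.trans eval_of_unit.symm)
  map_mul' x y := by
    obtain ⟨c, hc⟩ := x.2
    obtain ⟨d, hd⟩ := y.2
    have hxy := Classical.choose_spec (x * y).2
    rw [chi_eq_of_eval_eq hker hχ ((Classical.choose_spec x.2).trans hc.symm),
      chi_eq_of_eval_eq hker hχ ((Classical.choose_spec y.2).trans hd.symm), ← hχ.mul]
    refine chi_eq_of_eval_eq hker hχ (hxy.trans ?_)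
    rw [KZ.eval_mul', hc, hd]; rfl
  map_zero' := by
    rw [← map_zero χ]
    exact chi_eq_of_eval_eq hker hχ ((Classical.choose_spec (0 : Peff).2).trans (map_zero _).symm)
  map_add' x y := by
    obtain ⟨c, hc⟩ := x.2
    obtain ⟨d, hd⟩ := y.2
    have hxy := Classical.choose_spec (x + y).2
    rw [chi_eq_of_eval_eq hker hχ ((Classical.choose_spec x.2).trans hc.symm),
      chi_eq_of_eval_eq hker hχ ((Classical.choose_spec y.2).trans hd.symm), ← map_add]
    refine chi_eq_of_eval_eq hker hχ (hxy.trans ?_)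
    rw [map_add, hc, hd]; rfl

/-- `realise χ (eval c) = χ c`. [folklore] -/
theorem realise_eval (hker : KZKernelConjecture)
    {R : Type} [CommRing R] (χ : KZ.FormalRep →+ R) (hχ : IsRealisation R χ) (c : KZ.FormalRep) :
    realise hker χ hχ ⟨KZ.eval c, c, rfl⟩ = χ c :=
  chi_eq_of_eval_eq hker hχ (Classical.choose_spec (⟨KZ.eval c, c, rfl⟩ : Peff).2)

/-- **`Φ_KZ` has coefficients in `Peff`**: the lift of Drinfeld's associator to `Peff⟨⟨X₀,X₁⟩⟩`.
[cite: Furusho2003, Prop. 3.2.3] -/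
def phiPeff {Z : List ℕ → KZ.FormalRep} (_hZ : AgreesWithSimplex Z) : NCSeries Bool Peff :=
  fun W => ⟨KZ.eval (cruxLift Z W), cruxLift Z W, rfl⟩

/-- Its image in `ℝ` is `Φ_KZ`. [cite: Furusho2003, Prop. 3.2.3] -/
theorem map_val_phiPeff {Z : List ℕ → KZ.FormalRep} (hZ : AgreesWithSimplex Z) :
    NCSeries.map (Peff.val : Peff →ₐ[ℚ] ℝ).toRingHom (phiPeff hZ) = drinfeldAssociator := by
  funext W
  rw [NCSeries.map_apply]
  exact eval_cruxLift hZ W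

/-- **`Φ_KZ` satisfies the pentagon over `Peff`** (Drinfeld's theorem over `ℝ`, reflected along the
injective map of `ℚ`-algebras `Peff ↪ ℝ` by §6). [cite: Drinfeld1991, (2.13)] -/
theorem pentagon_phiPeff {Z : List ℕ → KZ.FormalRep} (hZ : AgreesWithSimplex Z) :
    NCSeries.DrinfeldPentagon (phiPeff hZ) := by
  refine NCSeries.DrinfeldPentagon.of_map_injective (Peff.val : Peff →ₐ[ℚ] ℝ).toRingHom
    Subtype.val_injective ?_
  rw [map_val_phiPeff hZ]
  exact drinfeldAssociator_pentagon_holds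

/-- Push-forward of `Φ_KZ ∈ Peff⟨⟨X₀,X₁⟩⟩` along the factorisation is the crux series. [folklore] -/
theorem map_realise_phiPeff (hker : KZKernelConjecture)
    {R : Type} [CommRing R] [Algebra ℚ R] (χ : KZ.FormalRep →+ R) (hχ : IsRealisation R χ)
    {Z : List ℕ → KZ.FormalRep} (hZ : AgreesWithSimplex Z) :
    NCSeries.map (realise hker χ hχ) (phiPeff hZ) = cruxSeries R χ Z := by
  funext W
  rw [NCSeries.map_apply, phiPeff, realise_eval, chi_cruxLift]

/-- **THE KERNEL FORM OF CONJECTURE 1 IMPLIES THE CRUX.**  If `ker eval = KZ.relations` then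
`PentagonInKZ` holds: every realisation factors through the `ℚ`-algebra of values `Peff ⊆ ℝ`
(`realise`), `Φ_KZ` satisfies the pentagon over `Peff` (`pentagon_phiPeff`: Drinfeld's theorem
reflected along `Peff ↪ ℝ`), and the pentagon is preserved by push-forward
(`DrinfeldPentagon.map`).  CONSEQUENCE FOR DISPROVERS: a refutation of the crux IS a refutation of
the kernel conjecture — it must exhibit a move-invariant `χ` finer than evaluation. [folklore] -/
theorem pentagonInKZ_of_kernel (hker : KZKernelConjecture) : PentagonInKZ := by
  rw [pentagonInKZ_iff']
  intro R _ _ χ hχ Z hZ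
  rw [← map_realise_phiPeff hker χ hχ hZ]
  exact (pentagon_phiPeff hZ).map _

/-- Contrapositive: **a refutation of the crux refutes the kernel conjecture.** [folklore] -/
theorem not_kernel_of_not_pentagonInKZ (h : ¬ PentagonInKZ) : ¬ KZKernelConjecture :=
  fun hk => h (pentagonInKZ_of_kernel hk)

/-- **THE SUMMIT IMPLIES THE CRUX**: `KontsevichZagierPeriods → PentagonInKZ` (the summit is the
two-representation form of Conjecture 1, equivalent in the tree to the kernel form:
`KontsevichZagierPeriods_iff`, `kzKernelConjecture_iff_isRational`). [folklore] -/
theorem pentagonInKZ_of_summit (h : KontsevichZagierPeriods) : PentagonInKZ :=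
  pentagonInKZ_of_kernel (kzKernelConjecture_iff_isRational.mpr (KontsevichZagierPeriods_iff.mp h))

/-- **A refutation of the crux refutes the summit** `KontsevichZagierPeriods` itself. [folklore] -/
theorem not_summit_of_not_pentagonInKZ (h : ¬ PentagonInKZ) : ¬ KontsevichZagierPeriods :=
  fun hs => h (pentagonInKZ_of_summit hs)


end Summit.KontsevichZagierPeriods.FurushoPentagon.PentagonInKZNegative
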